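import Summits.HubbardSuperconductivity.HubbardSuperconductivity.Theorems.AnisotropyChordTransferFibre3L2TCell

/-!
# Route `AnisotropyChord` / H0 rotor rung, LEVEL 2 row `N₁`, t-BLOCK `48 ≤ L ≤ 63`: the block cell of the column
# `ν ∈ [0.032569, 0.033383]` and its twelve kernel certificates

The `L2.TCell` (`…Fibre3L2TCell`) of the `ν`-column `[32569, 33383]/10⁶` for the t-block `L ∈ [48, 63]` of the range
`48 ≤ L < 128` (route-lead ruling R1): t-slot `[994669/100000000, 1713481/100000000]` (`⌊(2·piLo/63)²⌋`, `⌈(2·piHi/48)²⌉` to `10⁻⁸`),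
`T = 1714/10⁵ ≥ θ₀²`, window `K = 12`, and the twelve brackets of the normalised named sums
(`θ⁴S₂ ∈ [6.32782, 6.51613]`, …, `θ⁴Tx(1,1) ∈ [4.01747, 4.52054]`;
exact mirror `b1certG.py` of `B1.cellCheck 48` / `B1.txCellCheckG 48`), ★ `tcB048N32569_check` by one kernel `decide`.  The cell
files `…N1RowTa/TbB048N32569C….lean` of this column import it.
Prover seat `hubbard-h0-rotor-p2` g8; helper for piece A = stmt-HubbardSuperconductivity-23918 of rung 19089
(`--supports`, helper class).  Nothing here proves superconductivity in the Hubbard model; one kernel-certified piece of ONE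
conditional reduction (the GM₃ ∀L certificate, Level-2 row `N₁`, t-blocks `48 ≤ L < 128`, route-lead ruling R1); the rotor
TARGET as originally worded stays FALSE (g15 verdict).  Mathlib + the tree only; no sorry.  Generated by p2 g8's
scratch/tcells/mkcellT.py (copy in HOME/hubbard-h0-rotor-p2/scratch-g8/).
-/

set_option linter.dupNamespace false
set_option autoImplicit false

namespace Summit.HubbardSuperconductivity.HubbardSuperconductivity.Theorems.AnisotropyChord.Transfer.Fibre3.L2.N1

open Summit.HubbardSuperconductivity.HubbardSuperconductivity.Theorems.AnisotropyChord.Transfer.Fibre3.L2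

/-- the block cell of the column `ν ∈ [32569, 33383]/10⁶`, block `48 ≤ L ≤ 63`. -/
def tcB048N32569 : L2.TCell :=
  { L0 := 48,
    L1 := 63,
    tlo := 994669/100000000,
    thi := 1713481/100000000,
    n1 := 32569,
    n2 := 33383,
    νd := 1000000,
    Tn := 1714,
    Td := 100000,
    D := 1000000,
    bS2 := (395489/62500, 6516134617/1000000000),
    bS3 := (79761/15625, 1286178319/250000000),
    bS4 := (1216423/250000, 4911704357/1000000000),
    bT10 := (1915571/500000, 2034109107/500000000),
    bT11 := (2139839/500000, 2260270107/500000000),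
    bG21 := (34493/15625, 2230500111/1000000000),
    bG12 := (34493/15625, 2230500111/1000000000),
    bG22 := (81217/62500, 328199427/250000000),
    bG31 := (176961/100000, 446902427/250000000),
    bG13 := (176961/100000, 446902427/250000000),
    bTx10 := (1783521893/500000000, 2034109107/500000000),
    bTx11 := (2008732893/500000000, 2260270107/500000000) }

/-- ★ the twelve kernel certificates (and the t-slot scales) of the column hold. -/
theorem tcB048N32569_check : tcB048N32569.check = true := by decide +kernel

end Summit.HubbardSuperconductivity.HubbardSuperconductivity.Theorems.AnisotropyChord.Transfer.Fibre3.L2.N1
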